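import Literature.AlgebraicGeometry.Motives.GrassmannianOneChartOverlap
import Literature.AlgebraicGeometry.Motives.GrassmannianSchemeProper
import Literature.AlgebraicGeometry.Motives.MorphismsToProjectiveSpace
import Literature.AlgebraicGeometry.Morphisms.ProjectiveMorphism
import HarnessLib

/-!
# `Gr(1, L)` is projective over `ℤ`: the rank-one Grassmannian scheme embeds into `ℙ(L)`

Topic `AlgebraicGeometry/Motives`; namespace `Literature.AlgebraicGeometry.Motives.Grassmannian`.  THEOREMS ONLY.  F4 = sub-hand (P5′) of the
Plücker line (cell hodgecm-mathlib, (h4)): for a finite free abelian group `L` with basis `b : J → L`, the charts `U_j = Spec ℤ[X^{(j)}]` of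
`Gr = grassmannianScheme L 1` (★ `GrassmannianSchemeOpenCover`) and the transition coordinates `c_{jl} = x_l/x_j ∈ Γ(Gr, U_j)` form a
★ `Motives.GeneratingSections` datum (Hartshorne II Thm. 7.1 in the tree's invertible-sheaf-free currency): §1 `basicOpen_ratio_one`
(`Gr_{c_{jl}} = U_j ∩ U_l`, F4-2a), §3 the cocycle `ratio_mul_ratio_one` (restriction to the affine open `D(c_{jl}) ⊆ U_j` is injective and
there it is F4-1 `coordMap_mul_coordMap` for the tautological point), §4 `Γ(U_j) ≅ ℤ[X^{(j)}]` is generated by the ratios; hence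
Hartshorne II Prop. 7.2 (★ `isClosedImmersion_toProj`) makes `toProj : Gr ⟶ Proj ℤ[x_J] = ℙ^{n-1}_ℤ` a CLOSED IMMERSION (§5
`exists_generatingSections_one`, `exists_isClosedImmersion_toProj_one`) and §6 **`isProjective_terminal_from_one :
Morphisms.IsProjective (terminal.from (grassmannianScheme L 1))`**.  [Hartshorne1977, II Thm. 7.1, Prop. 7.2]; [GortzWedhorn2020,
(8.4), Example 15.12]; [StacksProject, Tag 089T, 01NE].  Nothing here is about HC — HC_CM is proved only modulo the 7 printed citations
until rung 0 closes.
-/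

universe u

open CategoryTheory CategoryTheory.Limits Opposite TensorProduct TopologicalSpace _root_.AlgebraicGeometry

namespace Literature.AlgebraicGeometry.Motives.Grassmannian

section RankOneCharts

variable (M : Type u) [AddCommGroup M] {J : Type u} (b : Module.Basis J ℤ M)

/-- A one-element frame `Fin 1 → J` is injective. [folklore] -/
private theorem inj1 (j : J) : Function.Injective (fun _ : Fin 1 => j) := Function.injective_of_subsingleton _

/-- The diagonal coordinate is `1`: `c_{jj} = chartCoordMap (b j) 0 = 1`. [cite: StacksProject, Tag 089T] -/
theorem chartCoordMap_one_self (j : J) : chartCoordMap 1 M b (fun _ => j) (b j) 0 = 1 := by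
  have h := chartCoordMap_frame 1 M b (fun _ : Fin 1 => j) (inj1 j) 0
  simp only [Function.comp_apply] at h
  rw [h, Pi.single_eq_same]

/-- The off-diagonal coordinate is the variable: `c_{jl} = X_{(l,0)}` for `l ≠ j`. [cite: StacksProject, Tag 089T] -/
theorem chartCoordMap_one_of_ne {j l : J} (h : l ≠ j) :
    chartCoordMap 1 M b (fun _ => j) (b l) 0 =
      chartVar 1 (fun _ : Fin 1 => j) (⟨l, by rintro ⟨_, rfl⟩; exact h rfl⟩, 0) := by
  rw [chartCoordMap, coordMapOfColumns_basis]

/-- **Coordinates of a pushed-forward universal chart point** `N = ψ_* (chartElemAffine I)`: `coordMap (b ∘ I) N m i = ψ (chartCoordMap m i)`.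
[cite: StacksProject, Tag 089T] -/
theorem coordMap_eq_of_map_chartElemAffine_eq {k : ℕ} (I : Fin k → J) (hI : Function.Injective I)
    {A : Type u} [CommRing A] (ψ : chartRing k I →ₐ[ℤ] A) (N : Module.Grassmannian A (A ⊗[ℤ] M) k)
    (hN : Module.Grassmannian.map ψ (chartElemAffine k M b I hI) = N) (h : N ∈ chart ℤ M k (⇑b ∘ I) A) (m : M) (i : Fin k) :
    coordMap (⇑b ∘ I) N h m i = ψ (chartCoordMap k M b I m i) := by
  subst hN
  rw [coordMap_map ψ (⇑b ∘ I) _ (chartElemAffine_mem_chart k M b I hI)]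
  have hc : coordMap (⇑b ∘ I) (chartElemAffine k M b I hI) (chartElemAffine_mem_chart k M b I hI) = chartCoordMap k M b I :=
    coordMap_ofCoordMap _ _ _
  rw [hc]
  rfl

/-- **The tautological point `h ≫ ι_I` of a chart, evaluated on an affine `T`**, is the push-forward of the universal chart point along
`ℤ[X_I] ≅ Γ(Spec ℤ[X_I], ⊤) → Γ(T, ⊤)`. [cite: GortzWedhorn2020, (8.4) (pp. 213–215)] [cite: StacksProject, Tag 089T] -/
theorem evalAffine_top_pointsEquiv_comp_symm_chartElem {k : ℕ} [(grassmannianSheaf M k).obj.IsRepresentable]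
    (I : {I : Fin k → J // Function.Injective I}) {T : Scheme.{u}} [IsAffine T] (h : T ⟶ chartScheme k I.1) :
    evalAffine (isAffineOpen_top T) (pointsEquiv M k T (h ≫ (chartOpenCover k M b).f I)) =
      Module.Grassmannian.map
        (h.appTop.hom.toIntAlgHom.comp (Scheme.ΓSpecIso (chartRing k I.1)).inv.hom.toIntAlgHom)
        (chartElemAffine k M b I.1 I.2) := by
  rw [chartOpenCover_f, pointsEquiv_comp_symm_chartElem, chartMap_app_apply,
    evalAffine_map h (isAffineOpen_top _) (isAffineOpen_top T) le_top, evalAffine_top, specEquiv_chartElem,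
    ← Module.Grassmannian.map_comp]
  congr 2
  ext x
  change (h.appLE ⊤ ⊤ le_top) _ = h.appTop _
  rw [GeneratingSections.appLE_top_top]

variable [(grassmannianSheaf M 1).obj.IsRepresentable]

/-! ## §1 Sections of `Gr` over a chart image -/

/-- The image `ι_j(⊤)` of the rank-one chart `Spec ℤ[X^{(j)}]` is an affine open of `Gr`. [cite: StacksProject, Tag 089T] -/
theorem isAffineOpen_image_top_chartι_one (j : J) :
    IsAffineOpen ((chartOpenCover 1 M b).f ⟨fun _ => j, inj1 j⟩ ''ᵁ ⊤) := by
  rw [Scheme.Hom.image_top_eq_opensRange]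
  haveI : IsAffine ((chartOpenCover 1 M b).X ⟨fun _ => j, inj1 j⟩) :=
    inferInstanceAs (IsAffine (chartScheme 1 fun _ : Fin 1 => j))
  exact isAffineOpen_opensRange _

/-- **The overlap of two chart images is the image of the basic open of the transition coordinate**:
`ι_j(⊤) ∩ ι_l(⊤) = ι_j(D(c_{jl}))`. [cite: Hartshorne1977, II Thm. 7.1] [cite: StacksProject, Tag 089T] -/
theorem image_top_inf_image_top_one (j l : J) :
    (chartOpenCover 1 M b).f ⟨fun _ => j, inj1 j⟩ ''ᵁ ⊤ ⊓ (chartOpenCover 1 M b).f ⟨fun _ => l, inj1 l⟩ ''ᵁ ⊤ =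
      (chartOpenCover 1 M b).f ⟨fun _ => j, inj1 j⟩ ''ᵁ
        (PrimeSpectrum.basicOpen (chartCoordMap 1 M b (fun _ => j) (b l) 0)) := by
  rw [← preimage_opensRange_chartι_one M b j l, Scheme.Hom.image_preimage_eq_opensRange_inf,
    Scheme.Hom.image_top_eq_opensRange, Scheme.Hom.image_top_eq_opensRange]

/-- **The basic open of the ratio section `x_l/x_j ∈ Γ(Gr, U_j)` is `U_j ∩ U_l`** (the `basicOpen_ratio` axiom of a
generating-sections datum). [cite: Hartshorne1977, II Thm. 7.1] [cite: StacksProject, Tag 089T] -/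
theorem basicOpen_ratio_one (j l : J) :
    (grassmannianScheme M 1).basicOpen
        ((((chartOpenCover 1 M b).f ⟨fun _ => j, inj1 j⟩).appIso ⊤).inv
          ((Scheme.ΓSpecIso (chartRing 1 fun _ : Fin 1 => j)).inv (chartCoordMap 1 M b (fun _ => j) (b l) 0))) =
      (chartOpenCover 1 M b).f ⟨fun _ => j, inj1 j⟩ ''ᵁ ⊤ ⊓ (chartOpenCover 1 M b).f ⟨fun _ => l, inj1 l⟩ ''ᵁ ⊤ := by
  rw [← Scheme.image_basicOpen, image_top_inf_image_top_one]
  congr 1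
  exact basicOpen_eq_of_affine _

/-- Variant of `image_top_inf_image_top_one` with the basic open written as `(Spec ℤ[X]).basicOpen` of a global section
(so that the open subscheme is an instance of `IsAffine`). [cite: Hartshorne1977, II Thm. 7.1] -/
theorem image_top_inf_image_top_one' (j l : J) :
    (chartOpenCover 1 M b).f ⟨fun _ => j, inj1 j⟩ ''ᵁ ⊤ ⊓ (chartOpenCover 1 M b).f ⟨fun _ => l, inj1 l⟩ ''ᵁ ⊤ =
      (chartOpenCover 1 M b).f ⟨fun _ => j, inj1 j⟩ ''ᵁ
        (((chartOpenCover 1 M b).X ⟨fun _ => j, inj1 j⟩).basicOpen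
          ((Scheme.ΓSpecIso (chartRing 1 fun _ : Fin 1 => j)).inv (chartCoordMap 1 M b (fun _ => j) (b l) 0))) := by
  rw [image_top_inf_image_top_one]
  congr 1
  exact (basicOpen_eq_of_affine _).symm

end RankOneCharts

/-! ## §2 Generic section calculus along an open immersion -/

section OpenImmersionSections

variable {X Y : Scheme.{u}} (f : X ⟶ Y) [IsOpenImmersion f]

/-- Restricting the section `(f.appIso ⊤)⁻¹ s ∈ Γ(Y, f(⊤))` along `V ↪ X → Y` gives `s|_V`. [folklore] -/
private theorem res_ι_comp_appIso_inv (V : X.Opens) (s : Γ(X, ⊤)) (h : ⊤ ≤ (V.ι ≫ f) ⁻¹ᵁ (f ''ᵁ ⊤)) :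
    GeneratingSections.res (V.ι ≫ f) (f ''ᵁ ⊤) h ((f.appIso ⊤).inv s) =
      X.presheaf.map (homOfLE (le_top : V.ι ''ᵁ ⊤ ≤ ⊤)).op s := by
  have e₁ : V ≤ f ⁻¹ᵁ f ''ᵁ ⊤ := by rw [Scheme.Hom.preimage_image_eq]; exact le_top
  have e₂ : (⊤ : (V : Scheme.{u}).Opens) ≤ V.ι ⁻¹ᵁ V := by rw [Scheme.Opens.ι_preimage_self]
  change ((V.ι ≫ f).appLE (f ''ᵁ ⊤) ⊤ h) ((f.appIso ⊤).inv s) = _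
  rw [← Scheme.Hom.appLE_comp_appLE V.ι f (f ''ᵁ ⊤) V ⊤ e₁ e₂, CommRingCat.comp_apply, ← CommRingCat.comp_apply _ (f.appLE _ _ _),
    Scheme.Hom.appIso_inv_appLE, Scheme.Opens.ι_appLE, ← CommRingCat.comp_apply]
  erw [← X.presheaf.map_comp]
  rfl

/-- Restricting the section `(f.appIso ⊤)⁻¹ s ∈ Γ(Y, f(⊤))` along `g ≫ f` gives `g^*(s)`. [folklore] -/
private theorem res_comp_appIso_inv {T : Scheme.{u}} (g : T ⟶ X) (s : Γ(X, ⊤)) (h : ⊤ ≤ (g ≫ f) ⁻¹ᵁ (f ''ᵁ ⊤)) :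
    GeneratingSections.res (g ≫ f) (f ''ᵁ ⊤) h ((f.appIso ⊤).inv s) = g.appTop s := by
  have hV : ⊤ ≤ f ⁻¹ᵁ f ''ᵁ ⊤ := by rw [Scheme.Hom.preimage_image_eq]
  rw [GeneratingSections.res_comp f (f ''ᵁ ⊤) hV g h, RingHom.comp_apply]
  change g.appTop ((f.appLE (f ''ᵁ ⊤) ⊤ hV) ((f.appIso ⊤).inv s)) = _
  rw [← Scheme.Hom.appIso_hom', Iso.inv_hom_id_apply]

/-- For an open immersion `g : T ⟶ Y` and an open `W = g(⊤)`, restriction of sections `Γ(Y, W) → Γ(T, ⊤)` is injective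
(indeed bijective: it is `g.appIso ⊤`). [folklore] -/
private theorem res_injective_of_image_top_eq {T : Scheme.{u}} (g : T ⟶ Y) [IsOpenImmersion g] (W : Y.Opens)
    (hW : g ''ᵁ ⊤ = W) (h : ⊤ ≤ g ⁻¹ᵁ W) : Function.Injective (GeneratingSections.res g W h) := by
  subst hW
  change Function.Injective (g.appLE (g ''ᵁ ⊤) ⊤ h)
  rw [← Scheme.Hom.appIso_hom']
  exact (g.appIso ⊤).commRingCatIsoToRingEquiv.injective

end OpenImmersionSections

/-! ## §3 The cocycle of the transition coordinates -/

section Cocycle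

variable (M : Type u) [AddCommGroup M] {J : Type u} (b : Module.Basis J ℤ M) [(grassmannianSheaf M 1).obj.IsRepresentable]

/-- **The cocycle `(x_l/x_j)|·(x_m/x_l)| = (x_m/x_j)|` on `U_j ∩ U_l`** for the ratio sections `((ι_j).appIso ⊤)⁻¹ (c_{jl})` of `Gr`
(the `ratio_mul_ratio` axiom): restrict (injectively) along `D(c_{jl}) ↪ Spec ℤ[X^{(j)}] → Gr` onto `U_j ∩ U_l`; there the three sections
are coordinates of one `Γ(D(c_{jl}), 𝒪)`-point of `Gr` in the charts `{j}`, `{l}` and F4-1 `coordMap_mul_coordMap` applies.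
[cite: Hartshorne1977, II Thm. 7.1] [cite: GortzWedhorn2020, (8.4) (pp. 213–215)] -/
theorem ratio_mul_ratio_one (j l m : J) :
    (grassmannianScheme M 1).presheaf.map (homOfLE inf_le_left).op
        ((((chartOpenCover 1 M b).f ⟨fun _ => j, inj1 j⟩).appIso ⊤).inv
          ((Scheme.ΓSpecIso (chartRing 1 fun _ : Fin 1 => j)).inv (chartCoordMap 1 M b (fun _ => j) (b l) 0))) *
      (grassmannianScheme M 1).presheaf.map (homOfLE inf_le_right).op
        ((((chartOpenCover 1 M b).f ⟨fun _ => l, inj1 l⟩).appIso ⊤).inv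
          ((Scheme.ΓSpecIso (chartRing 1 fun _ : Fin 1 => l)).inv (chartCoordMap 1 M b (fun _ => l) (b m) 0))) =
      (grassmannianScheme M 1).presheaf.map
        (homOfLE (inf_le_left : (chartOpenCover 1 M b).f ⟨fun _ => j, inj1 j⟩ ''ᵁ ⊤ ⊓
          (chartOpenCover 1 M b).f ⟨fun _ => l, inj1 l⟩ ''ᵁ ⊤ ≤ _)).op
        ((((chartOpenCover 1 M b).f ⟨fun _ => j, inj1 j⟩).appIso ⊤).inv
          ((Scheme.ΓSpecIso (chartRing 1 fun _ : Fin 1 => j)).inv (chartCoordMap 1 M b (fun _ => j) (b m) 0))) := by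
  haveI : IsAffine ((chartOpenCover 1 M b).X ⟨fun _ => j, inj1 j⟩) :=
    inferInstanceAs (IsAffine (chartScheme 1 fun _ : Fin 1 => j))
  have hW := image_top_inf_image_top_one' M b j l
  haveI hVaff : IsAffine ((((chartOpenCover 1 M b).X ⟨fun _ => j, inj1 j⟩).basicOpen
      ((Scheme.ΓSpecIso (chartRing 1 fun _ : Fin 1 => j)).inv (chartCoordMap 1 M b (fun _ => j) (b l) 0)) :
        ((chartOpenCover 1 M b).X ⟨fun _ => j, inj1 j⟩).Opens) : Scheme.{u}) :=
    (isAffineOpen_top ((chartOpenCover 1 M b).X ⟨fun _ => j, inj1 j⟩)).basicOpen _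
  set V : ((chartOpenCover 1 M b).X ⟨fun _ => j, inj1 j⟩).Opens := ((chartOpenCover 1 M b).X ⟨fun _ => j, inj1 j⟩).basicOpen
    ((Scheme.ΓSpecIso (chartRing 1 fun _ : Fin 1 => j)).inv (chartCoordMap 1 M b (fun _ => j) (b l) 0)) with hV
  have hgT : (V.ι ≫ (chartOpenCover 1 M b).f ⟨fun _ => j, inj1 j⟩) ''ᵁ ⊤ =
      (chartOpenCover 1 M b).f ⟨fun _ => j, inj1 j⟩ ''ᵁ ⊤ ⊓ (chartOpenCover 1 M b).f ⟨fun _ => l, inj1 l⟩ ''ᵁ ⊤ := by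
    rw [hW, Scheme.Hom.comp_image, Scheme.Opens.ι_image_top]
  have hle : ⊤ ≤ (V.ι ≫ (chartOpenCover 1 M b).f ⟨fun _ => j, inj1 j⟩) ⁻¹ᵁ
      ((chartOpenCover 1 M b).f ⟨fun _ => j, inj1 j⟩ ''ᵁ ⊤ ⊓ (chartOpenCover 1 M b).f ⟨fun _ => l, inj1 l⟩ ''ᵁ ⊤) := by
    rw [← hgT, Scheme.Hom.preimage_image_eq]
  have hlej : ⊤ ≤ (V.ι ≫ (chartOpenCover 1 M b).f ⟨fun _ => j, inj1 j⟩) ⁻¹ᵁ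
      ((chartOpenCover 1 M b).f ⟨fun _ => j, inj1 j⟩ ''ᵁ ⊤) := hle.trans (Scheme.Hom.preimage_mono _ inf_le_left)
  have hlel : ⊤ ≤ (V.ι ≫ (chartOpenCover 1 M b).f ⟨fun _ => j, inj1 j⟩) ⁻¹ᵁ
      ((chartOpenCover 1 M b).f ⟨fun _ => l, inj1 l⟩ ''ᵁ ⊤) := hle.trans (Scheme.Hom.preimage_mono _ inf_le_right)
  have hrange : Set.range (V.ι ≫ (chartOpenCover 1 M b).f ⟨fun _ => j, inj1 j⟩) ⊆
      Set.range ((chartOpenCover 1 M b).f ⟨fun _ => l, inj1 l⟩) := by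
    intro y hy
    have hy' : y ∈ ((V.ι ≫ (chartOpenCover 1 M b).f ⟨fun _ => j, inj1 j⟩) ''ᵁ ⊤ : Set _) := by
      obtain ⟨t, rfl⟩ := hy
      exact ⟨t, trivial, rfl⟩
    rw [hgT] at hy'
    have hy'' : y ∈ ((chartOpenCover 1 M b).f ⟨fun _ => l, inj1 l⟩ ''ᵁ ⊤ : Set _) := hy'.2
    rw [Scheme.Hom.image_top_eq_opensRange] at hy''
    exact hy''
  set g := IsOpenImmersion.lift ((chartOpenCover 1 M b).f ⟨fun _ => l, inj1 l⟩)
    (V.ι ≫ (chartOpenCover 1 M b).f ⟨fun _ => j, inj1 j⟩) hrange with hg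
  have hfac : g ≫ (chartOpenCover 1 M b).f ⟨fun _ => l, inj1 l⟩ = V.ι ≫ (chartOpenCover 1 M b).f ⟨fun _ => j, inj1 j⟩ :=
    IsOpenImmersion.lift_fac _ _ _
  have hlel' : ⊤ ≤ (g ≫ (chartOpenCover 1 M b).f ⟨fun _ => l, inj1 l⟩) ⁻¹ᵁ
      ((chartOpenCover 1 M b).f ⟨fun _ => l, inj1 l⟩ ''ᵁ ⊤) := by rw [hfac]; exact hlel
  have hinj := res_injective_of_image_top_eq (V.ι ≫ (chartOpenCover 1 M b).f ⟨fun _ => j, inj1 j⟩) _ hgT hle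
  apply hinj
  rw [map_mul, GeneratingSections.res_map _ _ hlej, GeneratingSections.res_map _ _ hlel, GeneratingSections.res_map _ _ hlej,
    res_ι_comp_appIso_inv, res_ι_comp_appIso_inv]
  have hb : GeneratingSections.res (V.ι ≫ (chartOpenCover 1 M b).f ⟨fun _ => j, inj1 j⟩)
      ((chartOpenCover 1 M b).f ⟨fun _ => l, inj1 l⟩ ''ᵁ ⊤) hlel =
      GeneratingSections.res (g ≫ (chartOpenCover 1 M b).f ⟨fun _ => l, inj1 l⟩)
      ((chartOpenCover 1 M b).f ⟨fun _ => l, inj1 l⟩ ''ᵁ ⊤) hlel' := by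
    simp only [hfac]
  rw [hb, res_comp_appIso_inv]
  set ρ : (chartRing 1 fun _ : Fin 1 => j) →ₐ[ℤ] Γ((V : Scheme.{u}), ⊤) :=
    V.ι.appTop.hom.toIntAlgHom.comp (Scheme.ΓSpecIso (chartRing 1 fun _ : Fin 1 => j)).inv.hom.toIntAlgHom with hρ
  set ρ' : (chartRing 1 fun _ : Fin 1 => l) →ₐ[ℤ] Γ((V : Scheme.{u}), ⊤) :=
    g.appTop.hom.toIntAlgHom.comp (Scheme.ΓSpecIso (chartRing 1 fun _ : Fin 1 => l)).inv.hom.toIntAlgHom with hρ'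
  set y := evalAffine (isAffineOpen_top (V : Scheme.{u}))
    (pointsEquiv M 1 (V : Scheme.{u}) (V.ι ≫ (chartOpenCover 1 M b).f ⟨fun _ => j, inj1 j⟩)) with hy
  have hyj : Module.Grassmannian.map ρ (chartElemAffine 1 M b (fun _ => j) (inj1 j)) = y :=
    (evalAffine_top_pointsEquiv_comp_symm_chartElem M b ⟨fun _ => j, inj1 j⟩ V.ι).symm
  have hyl : Module.Grassmannian.map ρ' (chartElemAffine 1 M b (fun _ => l) (inj1 l)) = y := by
    rw [hy, ← hfac]
    exact (evalAffine_top_pointsEquiv_comp_symm_chartElem M b ⟨fun _ => l, inj1 l⟩ g).symm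
  have hmj : y ∈ chart ℤ M 1 (⇑b ∘ fun _ : Fin 1 => j) Γ((V : Scheme.{u}), ⊤) :=
    hyj ▸ map_mem_chart ρ (chartElemAffine_mem_chart 1 M b (fun _ => j) (inj1 j))
  have hml : y ∈ chart ℤ M 1 (⇑b ∘ fun _ : Fin 1 => l) Γ((V : Scheme.{u}), ⊤) :=
    hyl ▸ map_mem_chart ρ' (chartElemAffine_mem_chart 1 M b (fun _ => l) (inj1 l))
  have key := coordMap_mul_coordMap (⇑b ∘ fun _ : Fin 1 => j) (⇑b ∘ fun _ : Fin 1 => l) y hmj hml (b m)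
  rw [coordMap_eq_of_map_chartElemAffine_eq M b _ _ ρ' y hyl hml,
    coordMap_eq_of_map_chartElemAffine_eq M b _ _ ρ y hyj hmj,
    coordMap_eq_of_map_chartElemAffine_eq M b _ _ ρ y hyj hmj] at key
  rw [mul_comm]
  exact key

end Cocycle

/-! ## §4 The chart ring is generated by the transition coordinates -/

section Generation

variable (M : Type u) [AddCommGroup M] {J : Type u} (b : Module.Basis J ℤ M)

/-- **`ℤ[X^{(j)}]` is generated as a ring by the coordinates `c_{jl}`, `l ∈ J`** (they are the variables, and `c_{jj} = 1`).
[cite: Hartshorne1977, II Prop. 7.2] -/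
theorem closure_range_chartCoordMap_one (j : J) :
    Subring.closure (Set.range fun l : J => chartCoordMap 1 M b (fun _ => j) (b l) 0) = ⊤ := by
  rw [eq_top_iff]
  rintro p -
  induction p using MvPolynomial.induction_on with
  | C z =>
    rw [eq_intCast]
    exact intCast_mem _ z
  | add p q hp hq => exact Subring.add_mem _ hp hq
  | mul_X p i hp =>
    obtain ⟨i1, i2⟩ := i
    obtain rfl : i2 = 0 := Subsingleton.elim _ _
    refine Subring.mul_mem _ hp (Subring.subset_closure ⟨i1.1, ?_⟩)
    change chartCoordMap 1 M b (fun _ => j) (b i1.1) 0 = chartVar 1 (fun _ : Fin 1 => j) (i1, 0)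
    rw [chartCoordMap_one_of_ne M b (fun h => i1.2 ⟨0, h.symm⟩)]

variable [(grassmannianSheaf M 1).obj.IsRepresentable]

/-- **`Γ(Gr, U_j)` is generated as a ring by the ratio sections `x_l/x_j`** (transport of `closure_range_chartCoordMap_one` along
`ℤ[X^{(j)}] ≅ Γ(Spec ℤ[X^{(j)}], ⊤) ≅ Γ(Gr, ι_j(⊤))`). [cite: Hartshorne1977, II Prop. 7.2] -/
theorem closure_range_ratio_one (j : J) :
    Subring.closure (Set.range fun l : J =>
      (((chartOpenCover 1 M b).f ⟨fun _ => j, inj1 j⟩).appIso ⊤).inv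
        ((Scheme.ΓSpecIso (chartRing 1 fun _ : Fin 1 => j)).inv (chartCoordMap 1 M b (fun _ => j) (b l) 0))) = ⊤ := by
  set γ : chartRing 1 (fun _ : Fin 1 => j) →+* Γ(grassmannianScheme M 1, (chartOpenCover 1 M b).f ⟨fun _ => j, inj1 j⟩ ''ᵁ ⊤) :=
    (((chartOpenCover 1 M b).f ⟨fun _ => j, inj1 j⟩).appIso ⊤).inv.hom.comp
      (Scheme.ΓSpecIso (chartRing 1 fun _ : Fin 1 => j)).inv.hom with hγ
  have hsurj : Function.Surjective γ :=
    (((chartOpenCover 1 M b).f ⟨fun _ => j, inj1 j⟩).appIso ⊤).symm.commRingCatIsoToRingEquiv.surjective.comp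
      (Scheme.ΓSpecIso (chartRing 1 fun _ : Fin 1 => j)).symm.commRingCatIsoToRingEquiv.surjective
  have hrange : (Set.range fun l : J =>
      (((chartOpenCover 1 M b).f ⟨fun _ => j, inj1 j⟩).appIso ⊤).inv
        ((Scheme.ΓSpecIso (chartRing 1 fun _ : Fin 1 => j)).inv (chartCoordMap 1 M b (fun _ => j) (b l) 0))) =
      γ '' Set.range (fun l : J => chartCoordMap 1 M b (fun _ => j) (b l) 0) := by
    rw [← Set.range_comp]
    rfl
  rw [hrange, ← RingHom.map_closure, closure_range_chartCoordMap_one, ← RingHom.range_eq_map, RingHom.range_eq_top]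
  exact hsurj

end Generation

/-! ## §5 The generating-sections datum and the projective embedding -/

section Assembly

variable (M : Type u) [AddCommGroup M] {J : Type u} (b : Module.Basis J ℤ M) [(grassmannianSheaf M 1).obj.IsRepresentable]

include b in
/-- **The rank-one charts of `Gr = grassmannianScheme M 1` and the transition coordinates form a generating-sections datum** (★
`Motives.GeneratingSections`, indexed by `Fin m` via `e : Fin m ≃ J`) with affine opens and SURJECTIVE chart ring maps
`ℤ[x_l/x_j : l] → Γ(Gr, U_j)` (the hypotheses of Hartshorne II Prop. 7.2). [cite: Hartshorne1977, II Thm. 7.1] [cite: Hartshorne1977, II Prop. 7.2]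
[cite: StacksProject, Tag 01NE] -/
theorem exists_generatingSections_one [Finite J] {m : ℕ} (e : Fin m ≃ J)
    (f : grassmannianScheme M 1 ⟶ Spec (.of (ULift.{u} ℤ))) :
    ∃ D : GeneratingSections (Fin m) (grassmannianScheme M 1),
      (∀ i, IsAffineOpen (D.U i)) ∧ ∀ i, Function.Surjective (D.sectionsRingHom f i) := by
  let D : GeneratingSections (Fin m) (grassmannianScheme M 1) :=
    { U := fun i => (chartOpenCover 1 M b).f ⟨fun _ => e i, inj1 (e i)⟩ ''ᵁ ⊤
      iSup_U := by
        rw [eq_top_iff]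
        rintro y -
        obtain ⟨⟨I, hI⟩, z, hz⟩ := (chartOpenCover 1 M b).exists_eq y
        have hII : (⟨fun _ => e (e.symm (I 0)), inj1 (e (e.symm (I 0)))⟩ : {I : Fin 1 → J // Function.Injective I}) =
            ⟨I, hI⟩ := Subtype.ext (funext fun i => by rw [Equiv.apply_symm_apply, Subsingleton.elim i 0])
        refine Opens.mem_iSup.2 ⟨e.symm (I 0), ?_⟩
        rw [hII, Scheme.Hom.image_top_eq_opensRange]
        exact ⟨z, hz⟩
      ratio := fun i i' =>
        (((chartOpenCover 1 M b).f ⟨fun _ => e i, inj1 (e i)⟩).appIso ⊤).inv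
          ((Scheme.ΓSpecIso (chartRing 1 fun _ : Fin 1 => e i)).inv (chartCoordMap 1 M b (fun _ => e i) (b (e i')) 0))
      ratio_self := fun i => by
        change _ = (1 : Γ(grassmannianScheme M 1, _))
        rw [chartCoordMap_one_self, map_one]
        exact map_one _
      basicOpen_ratio := fun i i' => basicOpen_ratio_one M b (e i) (e i')
      ratio_mul_ratio := fun i i' i'' => ratio_mul_ratio_one M b (e i) (e i') (e i'') }
  refine ⟨D, fun i => isAffineOpen_image_top_chartι_one M b (e i), fun i => ?_⟩
  refine D.sectionsRingHom_surjective_of_closure_eq_top f i (top_le_iff.1 ?_)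
  rw [← closure_range_ratio_one M b (e i)]
  refine Subring.closure_mono ?_
  rintro _ ⟨l, rfl⟩
  exact Or.inr ⟨e.symm l, by simp only [D, Equiv.apply_symm_apply]⟩

include b in
/-- **`Gr(1, M) ⟶ ℙ^{m-1}_ℤ = Proj ℤ[x_0, …, x_{m-1}]` is a closed immersion** (`m = rank M`; Hartshorne II Prop. 7.2 via
★ `GeneratingSections.isClosedImmersion_toProj`). [cite: Hartshorne1977, II Prop. 7.2] [cite: StacksProject, Tag 01NE] -/
theorem exists_isClosedImmersion_toProj_one [Finite J] {m : ℕ} (e : Fin m ≃ J)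
    (f : grassmannianScheme M 1 ⟶ Spec (.of (ULift.{u} ℤ))) :
    ∃ D : GeneratingSections (Fin m) (grassmannianScheme M 1), IsClosedImmersion (D.toProj f) := by
  obtain ⟨D, hU, hs⟩ := exists_generatingSections_one M b e f
  exact ⟨D, D.isClosedImmersion_toProj f hU hs⟩

end Assembly

/-! ## §6 THE GRASSMANNIAN OF RANK-ONE QUOTIENTS IS PROJECTIVE OVER `ℤ` -/

section Projective

/-- **`Gr(1, L)` IS PROJECTIVE OVER `ℤ`**: for a finite free abelian group `L`, `grassmannianScheme L 1 → ⊤ = Spec ℤ` is projective in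
Hartshorne's sense (★ `Morphisms.IsProjective`: a closed immersion into `ℙ(ι; ⊤) ≅ ℙ^{n-1}_ℤ`, `n = rank L`; Hartshorne II 7.1/7.2 on the
standard charts, `exists_isClosedImmersion_toProj_one`; for `L = 0` the scheme is empty). [cite: Hartshorne1977, II Prop. 7.2]
[cite: GortzWedhorn2020, Example 15.12 (Section (15.2), pp. 494–497)] [cite: StacksProject, Tag 01NE] -/
theorem isProjective_terminal_from_one (L : Type u) [AddCommGroup L] [Module.Finite ℤ L] [Module.Free ℤ L]
    [(grassmannianSheaf L 1).obj.IsRepresentable] :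
    Morphisms.IsProjective (terminal.from (grassmannianScheme L 1)) := by
  classical
  let b := Module.Free.chooseBasis ℤ L
  haveI : Fintype (Module.Free.ChooseBasisIndex ℤ L) := Fintype.ofFinite _
  rcases Nat.eq_zero_or_pos (Fintype.card (Module.Free.ChooseBasisIndex ℤ L)) with h0 | hpos
  · -- `L = 0`: no charts, the Grassmannian scheme is empty
    haveI : IsEmpty (Module.Free.ChooseBasisIndex ℤ L) := Fintype.card_eq_zero_iff.1 h0
    haveI : IsEmpty (grassmannianScheme L 1) := ⟨fun y => by
      obtain ⟨⟨I, -⟩, -, -⟩ := (chartOpenCover 1 L b).exists_eq y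
      exact isEmptyElim (I 0)⟩
    refine ⟨PEmpty.{u + 1}, inferInstance, isInitialOfIsEmpty.to _, inferInstance, ?_⟩
    exact terminal.hom_ext _ _
  · -- `n = rank L ≥ 1`: embed into `ℙ(ULift (Fin (n-1)); ⊤) = ⊤ × Proj ℤ[x_0, …, x_{n-1}]`
    set n := Fintype.card (Module.Free.ChooseBasisIndex ℤ L) with hn
    haveI : Finite (ULift.{u} (Fin (n - 1))) := inferInstance
    have hcard : Fintype.card (Module.Free.ChooseBasisIndex ℤ L) = Nat.card (ULift.{u} (Fin (n - 1))) + 1 := by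
      rw [Nat.card_ulift, Nat.card_fin, ← hn, Nat.sub_add_cancel hpos]
    let e : Fin (Nat.card (ULift.{u} (Fin (n - 1))) + 1) ≃ Module.Free.ChooseBasisIndex ℤ L :=
      (Fintype.equivFinOfCardEq hcard).symm
    obtain ⟨D, hD⟩ := exists_isClosedImmersion_toProj_one L b e (specULiftZIsTerminal.from _)
    refine ⟨ULift.{u} (Fin (n - 1)), inferInstance,
      pullback.lift (terminal.from _) (D.toProj (specULiftZIsTerminal.from _)) (terminal.hom_ext _ _), ?_,
      pullback.lift_fst _ _ _⟩
    have hsnd : IsIso (pullback.snd (terminal.from (⊤_ Scheme.{u}))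
        (terminal.from (Morphisms.projectiveSpaceInt (ULift.{u} (Fin (n - 1)))))) := by
      haveI : IsIso (terminal.from (⊤_ Scheme.{u})) := by
        rw [terminal.hom_ext (terminal.from (⊤_ Scheme.{u})) (𝟙 _)]
        infer_instance
      infer_instance
    have h := (MorphismProperty.cancel_right_of_respectsIso (P := @IsClosedImmersion)
      (pullback.lift (terminal.from _) (D.toProj (specULiftZIsTerminal.from _)) (terminal.hom_ext _ _))
      (pullback.snd (terminal.from (⊤_ Scheme.{u}))
        (terminal.from (Morphisms.projectiveSpaceInt (ULift.{u} (Fin (n - 1))))))).1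
    rw [pullback.lift_snd] at h
    exact h hD

end Projective

end Literature.AlgebraicGeometry.Motives.Grassmannian
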